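import Summits.AtomisticToContinuum.Crystallization.Theses.ReggeStarCoercivity
import Summits.AtomisticToContinuum.Crystallization.Theorems.ChargedEnergyGap.Negative.BlocksBound
import Summits.AtomisticToContinuum.Crystallization.Theorems.ChargedEnergyGap.Negative.BlocksLocal
import Summits.AtomisticToContinuum.Crystallization.Theorems.ReggeStarCoercivityPeriodicStarCoercivityDefs
import Summits.AtomisticToContinuum.Crystallization.Theorems.ReggeStarCoercivityPeriodicStarCoercivityCollarCount
import Summits.AtomisticToContinuum.Crystallization.Theorems.ReggeStarCoercivityStarCoercivity

/-!
# Skeleton rev 5 — crux `ReggeStarCoercivity.PeriodicStarCoercivity` (stmt-AtomisticToContinuum-13602),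
line `pinned-equilibria-reduction` driven to the route's DECLARED dependency (lead gen 1, 2026-08-16)

Crux (route file, fixed): `∃ g > 0, ∀ P : PeriodicConfiguration 3, ePer + g·#def(P)/#motif(P) ≤ e_LJ(P)`.

## Why this shape
Gen 0 of this line (skeleton rev 3c, `Lines/pinned_equilibria_reduction.lean`) landed the lever (S1 frozen descent,
p87416), the collar geometry (S5, p86679) and the vocabulary (Defs, p84249), and certified — with the drefute seat and the
triage panel — that the two remaining stubs S3′ (`stub_isolatedNearPay`, near engine) and S4 (`stub_farHealingOnEquilibria`,
far engine) are each the size of the sibling crux `StarCoercivity` (stmt-13600, two active line leads); both are IMPLIED by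
the crux (rev 3c §5 `isolatedNearPay_of_crux`, `farHealing_of_crux`).  The route files this crux with `deps: StarCoercivity`
("a consequence of X by trial blocks"); the tree holds the converse edge `StarCoercivityPeriodisation.stub_periodicTransfer :
PeriodicStarCoercivity → StarCoercivity` and, in a non-importable Cruxes work file only (`Cruxes/StarCoercivity/Disproof.lean`
§12, cdisprove g3), the block transfer `StarCoercivity → PeriodicStarCoercivity`.  Rev 5 therefore replaces S3′ ∧ S4 by that
transfer, built on the LANDED block API `ChargedEnergyGapNegative.Blocks` (`bpt`, `blockConfig`, `IsDeep`, `depth`,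
`exists_eq_toP_of_dist_lt`, `card_not_deep_le`, `exists_block_energy_le`) and gen 0's `isFree_add_iff`:

* `stub_blockShell`     (T1, M, provable now) — a `depth P 2`-deep block point reads, in the finite block, exactly the
                          `6/5`-shell it has in `P.points`;
* `stub_deepCount`      (T2, S, provable now) — `K³ − 6dK² ≤ #{d-deep coordinates of [0,K)³}`;
* `stub_rpowBound`      (T3, S, provable now) — `(m K³)^{2/3} ≤ m K²` for `m ≥ 1` (the `C·N^{2/3}` allowance is `o(K³)`);
* `stub_starCoercivity` (X = item stmt-AtomisticToContinuum-13600 BY NAME — the declared dependency; open).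

Glue (sorry-free, this file §2): `isDefective_block_iff` (T1 + `isFree_add_iff`), the DEFECT UNDERCOUNT
`defects_block_ge : #def(P)·(K³ − 6dK²) ≤ #Def(block_K)` (T1, T2), and the limit argument
`periodicStarCoercivity_of_starCoercivity` (blocks of `P` are finite near-competitors: feed `block_K` to X, use
`exists_block_energy_le`, T3, and let `K → ∞` by an explicit choice of `K`); whence `periodicStarCoercivity_iff_starCoercivity`
(with the landed converse) and `periodicStarCoercivity_of_coerciveTwoShellGap` (with the landed
`SeparationPaddingTransfer.stub_twoShellTransfer`, item 13956 ⇒ 13600 ⇒ 13602).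
`PeriodicStarCoercivity_of` concludes the route decl BY NAME from the four stubs.

## Disproof used (`Cruxes/PeriodicStarCoercivity/Disproof.lean`, cdisprove gen-2 v4, re-read 2026-08-16T10:30Z)
No `_false_without_` theorem; refuted strengthenings (η = 0, count, ∀ g, g ≥ 3/5) are not instantiated (T1–T3 are
identities/inequalities of bookkeeping; X is the sibling crux verbatim); §4's `BddBelow` is not needed here (the transfer
never evaluates `ePer`).  Cross-item note EQUIV-13600-13602 (cdisprove-13600 g3) is exactly what T1–T3 + glue re-prove
against importable modules.
-/

noncomputable section

open scoped BigOperators Classical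
open Literature.MathematicalPhysics.StatisticalMechanics Literature.Geometry.DiscreteGeometry
open Summit.AtomisticToContinuum.Crystallization.Theorems.ChargedEnergyGapNegative.Blocks

namespace Summit.AtomisticToContinuum.Crystallization.Theorems.ReggeStarCoercivityPeriodicStarCoercivity

/-! ## §0 Stand-ins for the finite-side vocabulary of `Theorems/ReggeStarCoercivityStarCoercivityPeriodisation.lean`
(`StarCoercivityPeriodisation.shell/IsDefective/defects`, landed by the 13600 lead but not yet built on the farm snapshot this
workfile elaborates against; the LANDED transfer file imports the real module — these three are byte-identical copies of its
bodies and are used only inside the glue, never in a registered stub signature). -/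

/-- The crux's finite shell of site `i` of `x` (other points within `6/5`, recentred, rescaled by `a⁻¹`) — copy of
`StarCoercivityPeriodisation.shell`. -/
def fshell {N : ℕ} (x : Fin N → (EuclideanSpace ℝ (Fin 3))) (i : Fin N) (a : ℝ) : Finset (EuclideanSpace ℝ (Fin 3)) :=
  (Finset.univ.filter fun j : Fin N => j ≠ i ∧ dist (x i) (x j) ≤ 6 / 5).image
    fun j => a⁻¹ • (x j - x i)

/-- Site `i` of `x` is defective (copy of `StarCoercivityPeriodisation.IsDefective`). -/
def FDefective {N : ℕ} (x : Fin N → (EuclideanSpace ℝ (Fin 3))) (i : Fin N) : Prop :=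
  ¬ ∃ a : ℝ, 9 / 10 ≤ a ∧ a ≤ 11 / 10 ∧
    (ShellCloseTo (1 / 20) (fshell x i a) fccKissingPattern ∨
     ShellCloseTo (1 / 20) (fshell x i a) hcpKissingPattern)

/-- `#Def(x)` (copy of `StarCoercivityPeriodisation.defects`). -/
def fdefects {N : ℕ} (x : Fin N → (EuclideanSpace ℝ (Fin 3))) : ℕ := Nat.card {i : Fin N // FDefective x i}

/-! ## §1 Registered stubs (the only `sorry`s of this file) -/

/-- **stub T1 — DEEP BLOCK POINTS READ THE SHELLS OF `P` (size M, provable now).** For a block index `u = (s, k)` of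
the `K`-block of `P` whose lattice coordinates `k` are `depth P 2`-deep, the crux's finite shell of the block configuration
at the corresponding `Fin`-index (other block points within `6/5`, recentred, rescaled by `a⁻¹`) is the periodic shell
`shell P (bpt P K u) a` read in `P.points`.  Proof: block points are points of `P` (`bpt_mem`), distinct (`blockConfig_injective`),
and every point of `P` within distance `< 2` of a `depth P 2`-deep block point is a block point (`exists_eq_toP_of_dist_lt`). -/
theorem stub_blockShell : ∀ (P : PeriodicConfiguration 3) (K : ℕ) (u : BIdx P K),
    IsDeep K (depth P 2) u.2 → ∀ a : ℝ,
      ((Finset.univ.filter fun j : Fin (Fintype.card (BIdx P K)) =>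
            j ≠ Fintype.equivFin (BIdx P K) u ∧
              dist (blockConfig P K (Fintype.equivFin (BIdx P K) u)) (blockConfig P K j) ≤ 6 / 5).image
          fun j => a⁻¹ • (blockConfig P K j - blockConfig P K (Fintype.equivFin (BIdx P K) u))) =
        shell P (bpt P K u) a := by
  sorry

/-- **stub T2 — ALMOST ALL COORDINATES ARE DEEP (size S, provable now).** At most `6dK²` of the `K³` lattice coordinates
of `[0, K)³` are not `d`-deep (`card_not_deep_le`), so at least `K³ − 6dK²` are. -/
theorem stub_deepCount : ∀ (K d : ℕ),
    (K : ℝ) ^ 3 - 6 * (d : ℝ) * (K : ℝ) ^ 2 ≤ (Nat.card {k : Fin 3 → Fin K // IsDeep K d k} : ℝ) := by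
  sorry

/-- **stub T3 — THE SUBLINEAR ALLOWANCE ON BLOCKS (size S, provable now).** `(m K³)^{2/3} = m^{2/3} K² ≤ m K²` for
`m ≥ 1` (`Real.mul_rpow`, `Real.rpow_natCast`, `Real.rpow_le_rpow_of_exponent_le`). -/
theorem stub_rpowBound : ∀ (m K : ℕ), 1 ≤ m →
    ((m : ℝ) * (K : ℝ) ^ 3) ^ (2 / 3 : ℝ) ≤ (m : ℝ) * (K : ℝ) ^ 2 := by
  sorry

/-- **stub X — THE DECLARED DEPENDENCY: `StarCoercivity` (item stmt-AtomisticToContinuum-13600, crux rank 2 of the same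
route, BY NAME; open, two active line leads).** -/
theorem stub_starCoercivity :
    Summit.AtomisticToContinuum.Crystallization.Theses.ReggeStarCoercivity.StarCoercivity := by
  sorry

/-! ## §2 Sorry-free glue: blocks of a periodic configuration are finite near-competitors -/

/-- A block point is its motif point translated by a period, so it has the same status. -/
theorem isFree_bpt_iff (P : PeriodicConfiguration 3) (K : ℕ) (u : BIdx P K) :
    IsFree P (bpt P K u) ↔ IsFree P (u.1 : EuclideanSpace ℝ (Fin 3)) := by
  show IsFree P ((u.1 : EuclideanSpace ℝ (Fin 3)) + latVec P (coords K u.2)) ↔ _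
  exact isFree_add_iff P (latVec_mem P _) _

/-- **A deep block point is defective in the block iff its motif point is defective in `P`.** -/
theorem isDefective_block_iff (P : PeriodicConfiguration 3) (K : ℕ) {u : BIdx P K}
    (hu : IsDeep K (depth P 2) u.2) :
    FDefective (blockConfig P K) (Fintype.equivFin (BIdx P K) u) ↔
      ¬ IsFree P (u.1 : EuclideanSpace ℝ (Fin 3)) := by
  rw [← isFree_bpt_iff P K u]
  unfold FDefective fshell IsFree Near
  simp only [stub_blockShell P K u hu]

/-- **Defect undercount**: the `K`-block of `P` has at least `#def(P) · (K³ − 6·depth·K²)` defective sites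
(one for each defective motif point and each `depth P 2`-deep lattice coordinate). -/
theorem defects_block_ge (P : PeriodicConfiguration 3) (K : ℕ) :
    ((defectSet P).card : ℝ) * ((K : ℝ) ^ 3 - 6 * (depth P 2 : ℝ) * (K : ℝ) ^ 2) ≤
      (fdefects (blockConfig P K) : ℝ) := by
  have hmem : ∀ s : ↥(defectSet P),
      (s : EuclideanSpace ℝ (Fin 3)) ∈ P.motif ∧ ¬ IsFree P s := fun s => by
    have h := s.2
    simp only [defectSet, Finset.mem_filter] at h
    exact h
  let f : ↥(defectSet P) × {k : Fin 3 → Fin K // IsDeep K (depth P 2) k} →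
      {i : Fin (Fintype.card (BIdx P K)) // FDefective (blockConfig P K) i} :=
    fun p => ⟨Fintype.equivFin (BIdx P K) (⟨p.1.1, (hmem p.1).1⟩, p.2.1),
      (isDefective_block_iff P K (u := (⟨p.1.1, (hmem p.1).1⟩, p.2.1)) p.2.2).2 (hmem p.1).2⟩
  have hf : Function.Injective f := by
    rintro ⟨s, k⟩ ⟨s', k'⟩ h
    have h1 : Fintype.equivFin (BIdx P K) (⟨s.1, (hmem s).1⟩, k.1) =
        Fintype.equivFin (BIdx P K) (⟨s'.1, (hmem s').1⟩, k'.1) := congrArg Subtype.val h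
    have h2 := (Fintype.equivFin (BIdx P K)).injective h1
    simp only [Prod.mk.injEq, Subtype.mk.injEq] at h2
    exact Prod.ext (Subtype.ext h2.1) (Subtype.ext h2.2)
  have hcard := Fintype.card_le_of_injective f hf
  rw [Fintype.card_prod, Fintype.card_coe] at hcard
  have hdef : (Fintype.card {i : Fin (Fintype.card (BIdx P K)) //
      FDefective (blockConfig P K) i} : ℝ) =
      (fdefects (blockConfig P K) : ℝ) := by
    unfold fdefects
    rw [Nat.card_eq_fintype_card]
  have hdeep := stub_deepCount K (depth P 2)
  rw [Nat.card_eq_fintype_card] at hdeep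
  have hD : (0 : ℝ) ≤ ((defectSet P).card : ℝ) := Nat.cast_nonneg _
  calc ((defectSet P).card : ℝ) * ((K : ℝ) ^ 3 - 6 * (depth P 2 : ℝ) * (K : ℝ) ^ 2)
      ≤ ((defectSet P).card : ℝ) *
          (Fintype.card {k : Fin 3 → Fin K // IsDeep K (depth P 2) k} : ℝ) :=
        mul_le_mul_of_nonneg_left hdeep hD
    _ ≤ (fdefects (blockConfig P K) : ℝ) := by
        rw [← hdef]; exact_mod_cast hcard

/-- **`StarCoercivity → PeriodicStarCoercivity` (items 13600 ⇒ 13602, same constant `g`) by TRIAL BLOCKS.**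
Fix `P` with `m` motif points, `D` of them defective, and suppose `e(P) = ePer + g·D/m − δ` with `δ > 0`.  Feed the
`K`-block `x_K` (`N = mK³` distinct points of `P`) to `StarCoercivity (g, C)`:
`N·ePer + g·#Def(x_K) − C·N^{2/3} ≤ E(x_K) ≤ N·(e(P) + δ/4)` for `K ≥ K₀(δ)` (`exists_block_energy_le`); with
`#Def(x_K) ≥ D(K³ − 6dK²)` (`defects_block_ge`) and `N^{2/3} ≤ mK²` this reads `(3/4)mδK³ ≤ (6gdD + C⁺m)K²`, false for
`K > (6gdD + C⁺m)/((3/4)mδ)`. -/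
theorem periodicStarCoercivity_of_starCoercivity
    (h : Summit.AtomisticToContinuum.Crystallization.Theses.ReggeStarCoercivity.StarCoercivity) :
    Summit.AtomisticToContinuum.Crystallization.Theses.ReggeStarCoercivity.PeriodicStarCoercivity := by
  obtain ⟨g, hg, C, hC⟩ := h
  refine ⟨g, hg, fun P => ?_⟩
  show ePer + g * ((defectSet P).card : ℝ) / (P.motif.card : ℝ) ≤ P.energyPerParticle lennardJones
  by_contra hlt
  push Not at hlt
  have hm : (0 : ℝ) < (P.motif.card : ℝ) := Nat.cast_pos.2 (Finset.card_pos.2 P.motif_nonempty)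
  have hm1 : 1 ≤ P.motif.card := Finset.card_pos.2 P.motif_nonempty
  have hD : (0 : ℝ) ≤ ((defectSet P).card : ℝ) := Nat.cast_nonneg _
  obtain ⟨δ, hδ⟩ : ∃ δ : ℝ,
      δ = ePer + g * ((defectSet P).card : ℝ) / (P.motif.card : ℝ) - P.energyPerParticle lennardJones := ⟨_, rfl⟩
  have hδpos : 0 < δ := by rw [hδ]; linarith
  have heP : P.energyPerParticle lennardJones =
      ePer + g * ((defectSet P).card : ℝ) / (P.motif.card : ℝ) - δ := by rw [hδ]; ring
  -- blocks are trial states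
  obtain ⟨K₀, hK₀pos, hK₀⟩ := exists_block_energy_le P (show (0 : ℝ) < δ / 4 by positivity)
  obtain ⟨C', hC'def⟩ : ∃ C' : ℝ, C' = max C 0 := ⟨_, rfl⟩
  have hC'0 : 0 ≤ C' := by rw [hC'def]; exact le_max_right _ _
  have hCC' : C ≤ C' := by rw [hC'def]; exact le_max_left _ _
  -- the block side `K`
  obtain ⟨K₁, hK₁⟩ := exists_nat_gt
    ((6 * g * (depth P 2 : ℝ) * ((defectSet P).card : ℝ) + C' * (P.motif.card : ℝ)) /
      (3 / 4 * (P.motif.card : ℝ) * δ))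
  obtain ⟨K, hKK₀, hKK₁⟩ : ∃ K : ℕ, K₀ ≤ K ∧ K₁ ≤ K := ⟨max K₀ K₁, le_max_left _ _, le_max_right _ _⟩
  have hKpos : (0 : ℝ) < K := by exact_mod_cast lt_of_lt_of_le hK₀pos hKK₀
  have hKK₁' : (K₁ : ℝ) ≤ K := by exact_mod_cast hKK₁
  have hN : ((Fintype.card (BIdx P K) : ℕ) : ℝ) = (P.motif.card : ℝ) * (K : ℝ) ^ 3 := by
    rw [card_BIdx]; push_cast; ring
  -- the crux on the block (definitional unfolding of the route decl into the named vocabulary)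
  have key : ((Fintype.card (BIdx P K) : ℕ) : ℝ) * ePer +
      g * (fdefects (blockConfig P K) : ℝ) -
        C * ((Fintype.card (BIdx P K) : ℕ) : ℝ) ^ (2 / 3 : ℝ) ≤
      interactionEnergy lennardJones (blockConfig P K) :=
    hC (Fintype.card (BIdx P K)) (blockConfig P K) (blockConfig_injective P K)
  have hE : interactionEnergy lennardJones (blockConfig P K) ≤
      ((Fintype.card (BIdx P K) : ℕ) : ℝ) * (P.energyPerParticle lennardJones + δ / 4) := hK₀ K hKK₀
  rw [hN] at key hE
  rw [heP] at hE
  have hdef := defects_block_ge P K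
  have hgdef : g * (((defectSet P).card : ℝ) * ((K : ℝ) ^ 3 - 6 * (depth P 2 : ℝ) * (K : ℝ) ^ 2)) ≤
      g * (fdefects (blockConfig P K) : ℝ) :=
    mul_le_mul_of_nonneg_left hdef hg.le
  have hrpow : ((P.motif.card : ℝ) * (K : ℝ) ^ 3) ^ (2 / 3 : ℝ) ≤ (P.motif.card : ℝ) * (K : ℝ) ^ 2 :=
    stub_rpowBound _ _ hm1
  have hrpow0 : 0 ≤ ((P.motif.card : ℝ) * (K : ℝ) ^ 3) ^ (2 / 3 : ℝ) :=
    Real.rpow_nonneg (mul_nonneg (Nat.cast_nonneg _) (pow_nonneg (Nat.cast_nonneg _) _)) _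
  have hCN : C * ((P.motif.card : ℝ) * (K : ℝ) ^ 3) ^ (2 / 3 : ℝ) ≤ C' * ((P.motif.card : ℝ) * (K : ℝ) ^ 2) :=
    (mul_le_mul_of_nonneg_right hCC' hrpow0).trans (mul_le_mul_of_nonneg_left hrpow hC'0)
  have hid : (P.motif.card : ℝ) * (K : ℝ) ^ 3 * (g * ((defectSet P).card : ℝ) / (P.motif.card : ℝ)) =
      g * ((defectSet P).card : ℝ) * (K : ℝ) ^ 3 := by
    rw [div_eq_mul_inv]
    calc (P.motif.card : ℝ) * (K : ℝ) ^ 3 * (g * ((defectSet P).card : ℝ) * (P.motif.card : ℝ)⁻¹)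
        = ((P.motif.card : ℝ) * (P.motif.card : ℝ)⁻¹) * (g * ((defectSet P).card : ℝ) * (K : ℝ) ^ 3) := by ring
      _ = g * ((defectSet P).card : ℝ) * (K : ℝ) ^ 3 := by rw [mul_inv_cancel₀ hm.ne', one_mul]
  -- combine: `(3/4) m δ K³ ≤ (6 g d D + C' m) K²`
  have hmain : 3 / 4 * (P.motif.card : ℝ) * δ * (K : ℝ) ^ 3 ≤
      (6 * g * (depth P 2 : ℝ) * ((defectSet P).card : ℝ) + C' * (P.motif.card : ℝ)) * (K : ℝ) ^ 2 := by
    linarith [key, hE, hCN, hgdef, hid]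
  -- contradiction with the choice of `K`
  have hpos : 0 < 3 / 4 * (P.motif.card : ℝ) * δ := mul_pos (mul_pos (by norm_num) hm) hδpos
  have hlt' : (6 * g * (depth P 2 : ℝ) * ((defectSet P).card : ℝ) + C' * (P.motif.card : ℝ)) /
      (3 / 4 * (P.motif.card : ℝ) * δ) < K := lt_of_lt_of_le hK₁ hKK₁'
  rw [div_lt_iff₀ hpos] at hlt'
  have hK2 : (0 : ℝ) < (K : ℝ) ^ 2 := by positivity
  have h3 : 3 / 4 * (P.motif.card : ℝ) * δ * (K : ℝ) * (K : ℝ) ^ 2 ≤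
      (6 * g * (depth P 2 : ℝ) * ((defectSet P).card : ℝ) + C' * (P.motif.card : ℝ)) * (K : ℝ) ^ 2 := by
    calc 3 / 4 * (P.motif.card : ℝ) * δ * (K : ℝ) * (K : ℝ) ^ 2
        = 3 / 4 * (P.motif.card : ℝ) * δ * (K : ℝ) ^ 3 := by ring
      _ ≤ _ := hmain
  have h4 := le_of_mul_le_mul_right h3 hK2
  linarith

/-- **13956 ⇒ 13602**: the sibling route's target `PhononSlackCertificates.CoerciveTwoShellGap` implies the torus crux
(through the landed `SeparationPaddingTransfer.stub_twoShellTransfer : CoerciveTwoShellGap → StarCoercivity`). -/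
theorem periodicStarCoercivity_of_coerciveTwoShellGap
    (h : Summit.AtomisticToContinuum.Crystallization.Theses.PhononSlackCertificates.CoerciveTwoShellGap) :
    Summit.AtomisticToContinuum.Crystallization.Theses.ReggeStarCoercivity.PeriodicStarCoercivity :=
  periodicStarCoercivity_of_starCoercivity (SeparationPaddingTransfer.stub_twoShellTransfer h)

end Summit.AtomisticToContinuum.Crystallization.Theorems.ReggeStarCoercivityPeriodicStarCoercivity

/-! ## §3 Skeleton theorem -/

namespace Summit.AtomisticToContinuum.Crystallization.Cruxes.PeriodicStarCoercivity.PinnedEquilibriaReduction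

open Summit.AtomisticToContinuum.Crystallization.Theorems.ReggeStarCoercivityPeriodicStarCoercivity

/-- **Skeleton theorem**: the crux BY NAME from the registered stubs (T1–T3 inside
`periodicStarCoercivity_of_starCoercivity`, X fed to it). -/
theorem PeriodicStarCoercivity_of :
    Summit.AtomisticToContinuum.Crystallization.Theses.ReggeStarCoercivity.PeriodicStarCoercivity :=
  periodicStarCoercivity_of_starCoercivity stub_starCoercivity

end Summit.AtomisticToContinuum.Crystallization.Cruxes.PeriodicStarCoercivity.PinnedEquilibriaReduction

end
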